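import Mathlib.LinearAlgebra.FiniteDimensional.Lemmas
import Mathlib.LinearAlgebra.Finsupp.Supported
import Literature.NumberTheory.Transcendental.RoySmallValueEstimatesInterpolationProofs
import Literature.NumberTheory.Transcendental.PhilipponCriterionProjDist
import HarnessLib

/-!
# Small value estimates at rational translates (Nguyen–Roy 2016) — proofs, VIII: the interpolating basis and Prop. 10

Eighth proofs file towards `Literature.NumberTheory.Transcendental.nguyenRoy2016_thm_1` (Nguyen–Roy,
IJNT 12 (2016) = arXiv:1412.5163), on top of the interpolation estimate of file VII
(`RoySmallValueEstimatesInterpolationProofs.lean`). Everything is PROVED.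

* `NguyenRoy.finrank_homogeneousSubmodule_fin_three` — `dim_ℂ ℂ[X₀,X₁,X₂]_L = (L+1)(L+2)/2`
  (monomials of degree `L` ↔ pairs `(b, ν)` with `b + ν ≤ L`, `NguyenRoy.trianglePairs`).
* `NguyenRoy.exists_dual_basis` — the second assertion of **Prop. 8** (up to the constant): the
  evaluation map `ℂ[X]_L → ℂ^M`, `Q ↦ (Q(γᵢ))_{i<M}`, `γᵢ = (1, ξ + ir, η sⁱ)`, `M = (L+1)(L+2)/2`, is
  bijective (injective by the estimate of file VII, dimensions agree), so there are forms `Q_j` of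
  degree `L` with `Q_j(γᵢ) = δ_{ij}` and `‖Q_j‖₁ ≤ c^{(L+1)³}`.
* `NguyenRoy.exists_projDist_le_of_small_on_ideal` — **Prop. 10** in test form and with the cruder
  interpolation constant: if `1 ≤ T ≤ M`, `L < D`, `‖α‖ = 1` and every form `P ∈ ℂ[X]_D` vanishing at
  `γ₀, …, γ_{T−1}` has `|P(α)| ≤ ‖P‖₁ ε` (i.e. `ε ≥ |I_D^{(T)}|_α` in the paper's notation, by (3.3)
  there), then `dist(α, γᵢ) ≤ 2M c^{(L+1)³} G^L ε` for some `i < T`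
  (`G = 1 + |ξ| + M|r| + |η||s|^M`; `dist = Nesterenko.projDist`). The paper's `c₃^{T^{3/2}}` follows
  with `L ≤ √(2T)`, `M ≤ 2T`; the argument is the printed one (basis `Q_j`, `X_k^L = ∑ a_j Q_j`,
  auxiliary forms `X_k^{D−L−1} E Qᵢ` and `X_k^{D−L} Qᵢ`).

Definitions here are plumbing (`trianglePairs`, the `Fintype` structure `fintypeDegreeEq` on the
monomials of degree `L`).

## References

* [NguyenRoy2016] N. A. V. Nguyen, D. Roy, IJNT 12 (2016) = arXiv:1412.5163, §3: Prop. 8 (second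
  assertion), Definition 9 (`I^{(T)}`, `|I_D^{(T)}|_α`), Prop. 10 and its proof.
-/

noncomputable section

open Polynomial Finset

namespace Literature.NumberTheory.Transcendental

namespace NguyenRoy

/-! ## Towards Prop. 10: the interpolating basis -/

section DualBasis

/-- The pairs `(b, ν)` with `b + ν ≤ L`. [folklore] -/
def trianglePairs (L : ℕ) : Finset (ℕ × ℕ) :=
  (range (L + 1) ×ˢ range (L + 1)).filter fun p => p.1 + p.2 ≤ L

/-- `#{(b, ν) : b + ν ≤ L} = (L+1)(L+2)/2`, in the form `2 · # = (L+1)(L+2)`. [folklore] -/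
theorem two_mul_card_trianglePairs (L : ℕ) : 2 * (trianglePairs L).card = (L + 1) * (L + 2) := by
  have h : (trianglePairs L).card = ∑ ν ∈ range (L + 1), (L - ν + 1) := by
    rw [trianglePairs, Finset.card_filter, Finset.sum_product_right]
    refine sum_congr rfl fun ν hν => ?_
    have hν' := mem_range.mp hν
    rw [Finset.sum_boole]
    have : (range (L + 1)).filter (fun b => b + ν ≤ L) = range (L - ν + 1) := by
      ext b; simp only [mem_filter, mem_range]; omega
    rw [this, card_range]
    rfl
  rw [h, ← Fin.sum_univ_eq_sum_range (fun ν => L - ν + 1), two_mul_sum_sub_add_one]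

/-- The monomials of degree `L` in three variables, as a `Fintype` through the bijection with
`trianglePairs L`. [folklore] -/
@[reducible] def fintypeDegreeEq (L : ℕ) : Fintype {m : Fin 3 →₀ ℕ // m.degree = L} :=
  Fintype.ofFinset ((trianglePairs L).image fun p => expVec L p.1 p.2) fun m => by
    constructor
    · intro hm
      obtain ⟨p, hp, rfl⟩ := mem_image.mp hm
      rw [trianglePairs, mem_filter] at hp
      show (expVec L p.1 p.2).degree = L
      rw [degree_expVec]; omega
    · intro (hm : m.degree = L)
      have hsum : m 0 + m 1 + m 2 = L := by
        rw [Finsupp.degree_eq_sum, Fin.sum_univ_three] at hm; exact hm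
      refine mem_image.mpr ⟨(m 1, m 2), ?_, ?_⟩
      · rw [trianglePairs, mem_filter, mem_product, mem_range, mem_range]; omega
      · ext i; fin_cases i
        · simp; omega
        · simp
        · simp

/-- **`dim_ℂ ℂ[X₀,X₁,X₂]_L = (L+1)(L+2)/2`**. [folklore] -/
theorem finrank_homogeneousSubmodule_fin_three (L : ℕ) :
    Module.finrank ℂ (MvPolynomial.homogeneousSubmodule (Fin 3) ℂ L) = (L + 1) * (L + 2) / 2 := by
  classical
  letI := fintypeDegreeEq L
  have e1 : (MvPolynomial.homogeneousSubmodule (Fin 3) ℂ L :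
      Submodule ℂ (MvPolynomial (Fin 3) ℂ)) =
      AddMonoidAlgebra.supported ℂ ℂ {m : Fin 3 →₀ ℕ | m.degree = L} :=
    MvPolynomial.homogeneousSubmodule_eq_finsupp_supported (Fin 3) ℂ L
  let e : MvPolynomial.homogeneousSubmodule (Fin 3) ℂ L ≃ₗ[ℂ] ({m : Fin 3 →₀ ℕ // m.degree = L} →₀ ℂ) :=
    (LinearEquiv.ofEq _ _ e1).trans (AddMonoidAlgebra.supportedEquivFinsupp _)
  rw [e.finrank_eq, (Finsupp.linearEquivFunOnFinite ℂ ℂ _).finrank_eq, Module.finrank_fintype_fun_eq_card]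
  -- the cardinality of the monomials
  have hcard : Fintype.card {m : Fin 3 →₀ ℕ // m.degree = L} =
      ((trianglePairs L).image fun p => expVec L p.1 p.2).card := Fintype.card_ofFinset _ _
  rw [hcard, Finset.card_image_of_injOn]
  · have := two_mul_card_trianglePairs L
    omega
  · intro p _ p' _ h
    have h1 := congrArg (fun d => d 1) h
    have h2 := congrArg (fun d => d 2) h
    simp only [expVec_one, expVec_two] at h1 h2
    exact Prod.ext h1 h2

/-- `‖Q‖₁ = 0` only for `Q = 0`. [folklore] -/
theorem eq_zero_of_l1Norm_le_zero {Q : MvPolynomial (Fin 3) ℂ} (h : Nesterenko.l1Norm Q ≤ 0) : Q = 0 := by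
  have h0 : ∀ d ∈ Q.support, ‖Q.coeff d‖ = 0 := by
    have hs := (Finset.sum_eq_zero_iff_of_nonneg (fun d _ => norm_nonneg (Q.coeff d))).mp
      (le_antisymm h (Nesterenko.l1Norm_nonneg Q))
    exact hs
  ext d
  rw [MvPolynomial.coeff_zero]
  by_cases hd : d ∈ Q.support
  · exact norm_eq_zero.mp (h0 d hd)
  · exact MvPolynomial.notMem_support_iff.mp hd

variable {r s ξ η : ℂ}

/-- **The interpolating basis** (second assertion of Prop. 8 up to the constant): for `r ≠ 0`,
`η ≠ 0`, `|s| > 1`, every `L` and `j < M = (L+1)(L+2)/2` there is a ternary form `Q_j` of degree `L`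
with `Q_j(γᵢ) = δ_{ij}` for `i < M` (`γᵢ = (1, ξ + ir, η sⁱ)`) and `‖Q_j‖₁ ≤ c^{(L+1)³}`,
`c = 16 max(1,|η|⁻¹)(1+|ξ|)max(1,|r|⁻¹)|s| min(1,|s|−1)⁻²`: the evaluation map `ℂ[X]_L → ℂ^M` is
injective by the interpolation estimate and the dimensions agree. [cite: NguyenRoy2016, Prop. 8] -/
theorem exists_dual_basis (hr : r ≠ 0) (hη : η ≠ 0) (hs : 1 < ‖s‖) (L : ℕ) (j : ℕ)
    (hj : j < (L + 1) * (L + 2) / 2) :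
    ∃ Q : MvPolynomial (Fin 3) ℂ, Q.IsHomogeneous L ∧
      (∀ i : ℕ, i < (L + 1) * (L + 2) / 2 →
        MvPolynomial.eval ![1, ξ + i * r, η * s ^ i] Q = if i = j then 1 else 0) ∧
      Nesterenko.l1Norm Q ≤
        (16 * (max 1 ‖η‖⁻¹ * (1 + ‖ξ‖) * max 1 ‖r‖⁻¹) * ‖s‖ * (min 1 (‖s‖ - 1))⁻¹ ^ 2) ^
          ((L + 1) ^ 3) := by
  classical
  set M := (L + 1) * (L + 2) / 2 with hM
  set V := MvPolynomial.homogeneousSubmodule (Fin 3) ℂ L with hV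
  -- the evaluation map
  let ev : V →ₗ[ℂ] (Fin M → ℂ) :=
    (LinearMap.pi fun i : Fin M =>
      (MvPolynomial.aeval ![(1 : ℂ), ξ + (i : ℕ) * r, η * s ^ (i : ℕ)]).toLinearMap).comp V.subtype
  have hev : ∀ (Q : V) (i : Fin M), ev Q i =
      MvPolynomial.eval ![(1 : ℂ), ξ + (i : ℕ) * r, η * s ^ (i : ℕ)] (Q : MvPolynomial (Fin 3) ℂ) := by
    intro Q i
    change MvPolynomial.aeval _ (Q : MvPolynomial (Fin 3) ℂ) = _
    rw [MvPolynomial.aeval_def, Algebra.algebraMap_self]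
    rfl
  have hmem : ∀ Q : V, (Q : MvPolynomial (Fin 3) ℂ).IsHomogeneous L := fun Q =>
    (MvPolynomial.mem_homogeneousSubmodule L _).mp Q.2
  -- injectivity, by the interpolation estimate with `B = 0`
  have hinj : Function.Injective ev := by
    intro Q₁ Q₂ h
    rw [← sub_eq_zero]
    have hvals : ∀ i : ℕ, i < (L + 1) * (L + 2) / 2 →
        ‖MvPolynomial.eval ![1, ξ + i * r, η * s ^ i] ((Q₁ - Q₂ : V) : MvPolynomial (Fin 3) ℂ)‖ ≤ 0 := by
      intro i hi
      have h' := congrFun h ⟨i, hi⟩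
      rw [hev, hev] at h'
      rw [Submodule.coe_sub, map_sub, h', sub_self, norm_zero]
    have hle := l1Norm_le_pow_mul_of_eval_translates hr hη hs (hmem (Q₁ - Q₂)) hvals
    rw [mul_zero] at hle
    exact Subtype.ext (eq_zero_of_l1Norm_le_zero hle)
  -- dimensions agree
  have hMpos : 0 < M := by
    rw [hM]
    refine Nat.div_pos ?_ two_pos
    have key : (L + 1) * (L + 2) = 2 + (L ^ 2 + 3 * L) := by ring
    omega
  have hdim : Module.finrank ℂ V = Module.finrank ℂ (Fin M → ℂ) := by
    rw [hV, finrank_homogeneousSubmodule_fin_three, Module.finrank_fintype_fun_eq_card, Fintype.card_fin]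
  haveI : Module.Finite ℂ V := Module.finite_of_finrank_pos (by rw [hdim]; simpa using hMpos)
  let e := ev.linearEquivOfInjective hinj hdim
  set Qj : V := e.symm (Pi.single (⟨j, hj⟩ : Fin M) 1) with hQj
  have hvalues : ∀ i : ℕ, i < (L + 1) * (L + 2) / 2 →
      MvPolynomial.eval ![1, ξ + i * r, η * s ^ i] (Qj : MvPolynomial (Fin 3) ℂ) = if i = j then 1 else 0 := by
    intro i hi
    have h1 : ev Qj ⟨i, hi⟩ = (Pi.single (⟨j, hj⟩ : Fin M) (1 : ℂ) : Fin M → ℂ) ⟨i, hi⟩ := by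
      rw [hQj, ← LinearMap.linearEquivOfInjective_apply hinj hdim, LinearEquiv.apply_symm_apply]
    rw [hev] at h1
    rw [h1, Pi.single_apply]
    simp only [Fin.mk.injEq]
  refine ⟨(Qj : MvPolynomial (Fin 3) ℂ), hmem Qj, hvalues, ?_⟩
  have h := l1Norm_le_pow_mul_of_eval_translates hr hη hs (hmem Qj) (B := 1) (fun i hi => by
    rw [hvalues i hi]; split_ifs <;> simp)
  rwa [mul_one] at h

end DualBasis

/-! ## Prop. 10: a point at which `I_D^{(T)}` is small is close to one of `γ₀, …, γ_{T−1}` -/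

section ClosestPoint

open Literature.NumberTheory.Transcendental.Nesterenko

variable {r s ξ η : ℂ}

/-- Two forms of degree `L` with the same values at `γ₀, …, γ_{M−1}` coincide. [cite: NguyenRoy2016, Prop. 8] -/
theorem eq_of_eval_translates_eq (hr : r ≠ 0) (hη : η ≠ 0) (hs : 1 < ‖s‖) {L : ℕ}
    {P P' : MvPolynomial (Fin 3) ℂ} (hP : P.IsHomogeneous L) (hP' : P'.IsHomogeneous L)
    (h : ∀ i : ℕ, i < (L + 1) * (L + 2) / 2 →
      MvPolynomial.eval ![1, ξ + i * r, η * s ^ i] P = MvPolynomial.eval ![1, ξ + i * r, η * s ^ i] P') :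
    P = P' := by
  rw [← sub_eq_zero]
  refine eq_zero_of_l1Norm_le_zero ?_
  have hle := l1Norm_le_pow_mul_of_eval_translates hr hη hs (hP.sub hP') (B := 0) (fun i hi => by
    rw [map_sub, h i hi, sub_self, norm_zero])
  rwa [mul_zero] at hle

/-- `‖X_k^n‖₁ = 1`. [folklore] -/
theorem l1Norm_X_pow_eq_one (k : Fin 3) (n : ℕ) : l1Norm ((MvPolynomial.X k : MvPolynomial (Fin 3) ℂ) ^ n) = 1 := by
  rw [MvPolynomial.X_pow_eq_monomial, l1Norm_monomial, norm_one]

/-- `‖c X_a‖₁ = |c|`. [folklore] -/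
theorem l1Norm_C_mul_X (c : ℂ) (a : Fin 3) : l1Norm (MvPolynomial.C c * MvPolynomial.X a) = ‖c‖ := by
  rw [MvPolynomial.C_mul_X_eq_monomial, l1Norm_monomial]

/-- The projective distance is at most `2`. [cite: NguyenRoy2016, §2] -/
theorem projDist_le_two {m : ℕ} (φ ψ : Fin (m + 1) → ℂ) : projDist φ ψ ≤ 2 := by
  rcases eq_or_ne φ 0 with hφ | hφ
  · rw [hφ, projDist]; simp
  rcases eq_or_ne ψ 0 with hψ | hψ
  · rw [hψ, projDist]; simp
  have hpos : 0 < ‖φ‖ * ‖ψ‖ := mul_pos (norm_pos_iff.mpr hφ) (norm_pos_iff.mpr hψ)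
  rw [projDist, div_le_iff₀ hpos]
  refine PhilipponMain.sup_minor_le _ _ (by positivity) fun p => ?_
  calc ‖φ p.1.1 * ψ p.1.2 - φ p.1.2 * ψ p.1.1‖ ≤ ‖φ p.1.1 * ψ p.1.2‖ + ‖φ p.1.2 * ψ p.1.1‖ :=
        norm_sub_le _ _
    _ ≤ ‖φ‖ * ‖ψ‖ + ‖φ‖ * ‖ψ‖ := by
        rw [norm_mul, norm_mul]
        exact add_le_add (mul_le_mul (norm_le_pi_norm _ _) (norm_le_pi_norm _ _) (norm_nonneg _)
          (norm_nonneg _)) (mul_le_mul (norm_le_pi_norm _ _) (norm_le_pi_norm _ _) (norm_nonneg _)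
          (norm_nonneg _))
    _ = 2 * (‖φ‖ * ‖ψ‖) := by ring

/-- The points `γᵢ = (1, ξ + ir, η sⁱ)` are non-zero. [folklore] -/
theorem gammaPt_ne_zero (ξ η r s : ℂ) (i : ℕ) : (![1, ξ + i * r, η * s ^ i] : Fin 3 → ℂ) ≠ 0 := by
  intro h
  have := congrFun h 0
  simp at this

/-- `1 ≤ ‖γᵢ‖ ≤ 1 + |ξ| + M|r| + |η||s|^M` for `i < M` (`|s| ≥ 1`). [folklore] -/
theorem norm_gammaPt_le (ξ η r s : ℂ) (hs : 1 ≤ ‖s‖) {M i : ℕ} (hi : i < M) :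
    ‖(![1, ξ + i * r, η * s ^ i] : Fin 3 → ℂ)‖ ≤ 1 + ‖ξ‖ + M * ‖r‖ + ‖η‖ * ‖s‖ ^ M := by
  have h0 : 0 ≤ ‖ξ‖ := norm_nonneg _
  have h1 : 0 ≤ (M : ℝ) * ‖r‖ := by positivity
  have h2 : 0 ≤ ‖η‖ * ‖s‖ ^ M := by positivity
  refine (pi_norm_le_iff_of_nonneg (by positivity)).mpr fun t => ?_
  fin_cases t
  · simp; linarith
  · show ‖ξ + i * r‖ ≤ _
    calc ‖ξ + i * r‖ ≤ ‖ξ‖ + ‖(i : ℂ) * r‖ := norm_add_le _ _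
      _ = ‖ξ‖ + i * ‖r‖ := by rw [norm_mul, Complex.norm_natCast]
      _ ≤ ‖ξ‖ + M * ‖r‖ := by gcongr
      _ ≤ _ := by linarith
  · show ‖η * s ^ i‖ ≤ _
    calc ‖η * s ^ i‖ = ‖η‖ * ‖s‖ ^ i := by rw [norm_mul, norm_pow]
      _ ≤ ‖η‖ * ‖s‖ ^ M := by gcongr
      _ ≤ _ := by linarith

/-- `1 ≤ ‖γᵢ‖`. [folklore] -/
theorem one_le_norm_gammaPt (ξ η r s : ℂ) (i : ℕ) : 1 ≤ ‖(![1, ξ + i * r, η * s ^ i] : Fin 3 → ℂ)‖ := by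
  calc (1 : ℝ) = ‖(![1, ξ + i * r, η * s ^ i] : Fin 3 → ℂ) 0‖ := by simp
    _ ≤ _ := norm_le_pi_norm _ 0

/-- **Nguyen–Roy 2016, Proposition 10 (with the cruder interpolation constant), test form.** Let
`r ≠ 0`, `η ≠ 0`, `|s| > 1`, `ξ ∈ ℂ`, `γᵢ = (1, ξ + ir, η sⁱ)`; let `1 ≤ T ≤ C(L+2, 2) = M` and
`L < D` (the paper takes `L` smallest with `T ≤ M`, which forces `L < D` from `T ≤ C(D+1, 2)`), and
let `α ∈ ℂ³` be a representative of norm `1`. If every form `P ∈ ℂ[X]_D` vanishing at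
`γ₀, …, γ_{T−1}` (i.e. `P ∈ I_D^{(T)}`) satisfies `|P(α)| ≤ ‖P‖₁ · ε` (this is `|P(α)| ≤ 𝓛(P) |I_D^{(T)}|_α`,
(3.3) of the printed proof, with `ε = |I_D^{(T)}|_α`), then
`dist(α, {γ₀, …, γ_{T−1}}) ≤ 2 M · c^{(L+1)³} · G^L · ε`, `G = 1 + |ξ| + M|r| + |η||s|^M ≥ ‖γᵢ‖` (`i < M`),
`c` the interpolation constant of `exists_dual_basis`. The printed bound is `c₃^{T^{3/2}} |I_D^{(T)}|_α`
(use `L ≤ √(2T)`, `M ≤ 2T`); the argument (the basis `Q_j` with `Q_j(γᵢ) = δ_{ij}`,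
`X_k^L = ∑ a_j Q_j`, and the auxiliary forms `X_k^{D−L−1} E Qᵢ`, `X_k^{D−L} Qᵢ`) is the paper's.
[cite: NguyenRoy2016, Prop. 10] -/
theorem exists_projDist_le_of_small_on_ideal (hr : r ≠ 0) (hη : η ≠ 0) (hs : 1 < ‖s‖)
    {D T L : ℕ} (hT : 1 ≤ T) (hTM : T ≤ (L + 1) * (L + 2) / 2) (hLD : L < D)
    {α : Fin 3 → ℂ} (hα : ‖α‖ = 1) {ε : ℝ} (hε : 0 ≤ ε)
    (hI : ∀ P : MvPolynomial (Fin 3) ℂ, P.IsHomogeneous D →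
      (∀ i : ℕ, i < T → MvPolynomial.eval ![1, ξ + i * r, η * s ^ i] P = 0) →
      ‖MvPolynomial.eval α P‖ ≤ l1Norm P * ε) :
    ∃ i : ℕ, i < T ∧ projDist α ![1, ξ + i * r, η * s ^ i] ≤
      2 * ((L + 1) * (L + 2) / 2 : ℕ) *
        (16 * (max 1 ‖η‖⁻¹ * (1 + ‖ξ‖) * max 1 ‖r‖⁻¹) * ‖s‖ * (min 1 (‖s‖ - 1))⁻¹ ^ 2) ^
          ((L + 1) ^ 3) *
        (1 + ‖ξ‖ + ((L + 1) * (L + 2) / 2 : ℕ) * ‖r‖ + ‖η‖ * ‖s‖ ^ ((L + 1) * (L + 2) / 2)) ^ L * ε := by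
  classical
  set M := (L + 1) * (L + 2) / 2 with hM
  set K₁ : ℝ := (16 * (max 1 ‖η‖⁻¹ * (1 + ‖ξ‖) * max 1 ‖r‖⁻¹) * ‖s‖ * (min 1 (‖s‖ - 1))⁻¹ ^ 2) ^
    ((L + 1) ^ 3) with hK₁
  set G : ℝ := 1 + ‖ξ‖ + M * ‖r‖ + ‖η‖ * ‖s‖ ^ M with hG
  set γ : ℕ → Fin 3 → ℂ := fun i => ![1, ξ + i * r, η * s ^ i] with hγ
  have hMT : 0 < M := lt_of_lt_of_le hT hTM
  -- the interpolating basis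
  have hQ : ∀ j : Fin M, ∃ Q : MvPolynomial (Fin 3) ℂ, Q.IsHomogeneous L ∧
      (∀ i : ℕ, i < M → MvPolynomial.eval (γ i) Q = if i = j then 1 else 0) ∧ l1Norm Q ≤ K₁ :=
    fun j => exists_dual_basis hr hη hs L j j.2
  choose Q hQhom hQval hQlen using hQ
  -- a coordinate `k` with `|α_k| = 1`
  obtain ⟨k, hk⟩ := PhilipponMain.exists_norm_eq_norm_apply α
  rw [hα] at hk
  have hα0 : α ≠ 0 := fun h => by rw [h, norm_zero] at hα; exact zero_ne_one hα
  -- `X_k^L = ∑ a_j Q_j`, `a_j = (γ_j)_k^L`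
  set a : Fin M → ℂ := fun j => (γ j k) ^ L with ha
  have hexp : (MvPolynomial.X k : MvPolynomial (Fin 3) ℂ) ^ L = ∑ j, MvPolynomial.C (a j) * Q j := by
    refine eq_of_eval_translates_eq (ξ := ξ) hr hη hs (MvPolynomial.isHomogeneous_X_pow _ _)
      (MvPolynomial.IsHomogeneous.sum _ _ _ fun j _ => ?_) fun i hi => ?_
    · simpa using (MvPolynomial.isHomogeneous_C _ (a j)).mul (hQhom j)
    · rw [map_pow, MvPolynomial.eval_X, map_sum]
      simp_rw [map_mul, MvPolynomial.eval_C]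
      rw [Finset.sum_eq_single (⟨i, hi⟩ : Fin M)]
      · rw [hQval _ i hi, if_pos rfl, mul_one]
      · intro j _ hj
        rw [hQval _ i hi, if_neg (fun h => hj (Fin.ext h.symm)), mul_zero]
      · intro h; exact absurd (mem_univ _) h
  -- evaluate at `α` and pick the largest term
  have heval : α k ^ L = ∑ j, a j * MvPolynomial.eval α (Q j) := by
    have := congrArg (MvPolynomial.eval α) hexp
    rw [map_pow, MvPolynomial.eval_X, map_sum] at this
    simp_rw [map_mul, MvPolynomial.eval_C] at this
    exact this
  obtain ⟨i₀, -, hi₀⟩ := Finset.exists_max_image (univ : Finset (Fin M))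
    (fun j => ‖a j‖ * ‖MvPolynomial.eval α (Q j)‖) ⟨⟨0, hMT⟩, mem_univ _⟩
  have hGa : ∀ j : Fin M, ‖a j‖ ≤ G ^ L := fun j => by
    rw [ha, norm_pow]
    refine pow_le_pow_left₀ (norm_nonneg _) ((norm_le_pi_norm _ k).trans ?_) _
    exact norm_gammaPt_le ξ η r s hs.le j.2
  have hG1 : 1 ≤ G := by
    have : 0 ≤ ‖ξ‖ + M * ‖r‖ + ‖η‖ * ‖s‖ ^ M := by positivity
    rw [hG]; linarith
  have hstar : 1 ≤ M * G ^ L * ‖MvPolynomial.eval α (Q i₀)‖ := by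
    calc (1 : ℝ) = ‖α k ^ L‖ := by rw [norm_pow, ← hk, one_pow]
      _ = ‖∑ j, a j * MvPolynomial.eval α (Q j)‖ := by rw [heval]
      _ ≤ ∑ j, ‖a j‖ * ‖MvPolynomial.eval α (Q j)‖ :=
          (norm_sum_le _ _).trans (le_of_eq (sum_congr rfl fun j _ => norm_mul _ _))
      _ ≤ ∑ _j : Fin M, ‖a i₀‖ * ‖MvPolynomial.eval α (Q i₀)‖ := sum_le_sum fun j _ => hi₀ j (mem_univ _)
      _ = M * (‖a i₀‖ * ‖MvPolynomial.eval α (Q i₀)‖) := by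
          rw [sum_const, card_univ, Fintype.card_fin, nsmul_eq_mul]
      _ ≤ M * (G ^ L * ‖MvPolynomial.eval α (Q i₀)‖) := by gcongr; exact hGa i₀
      _ = _ := by ring
  have hK₁0 : 0 ≤ K₁ := (l1Norm_nonneg _).trans (hQlen i₀)
  have hbig : 0 ≤ 2 * (M : ℝ) * K₁ * G ^ L * ε := by positivity
  by_cases hiT : (i₀ : ℕ) < T
  · -- Case `i₀ < T`: the auxiliary form `X_k^{D−L−1} E Q_{i₀}`
    set γ₀ := γ i₀ with hγ₀
    have hγ₀ne : γ₀ ≠ 0 := gammaPt_ne_zero ξ η r s i₀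
    have hne : (univ : Finset (SkewIdx 2)).Nonempty := ⟨⟨((0 : Fin 3), (1 : Fin 3)), by decide⟩, mem_univ _⟩
    obtain ⟨p, -, hp⟩ := Finset.exists_mem_eq_sup (univ : Finset (SkewIdx 2)) hne
      (fun q => ‖α q.1.1 * γ₀ q.1.2 - α q.1.2 * γ₀ q.1.1‖₊)
    have hdist : projDist α γ₀ * (‖α‖ * ‖γ₀‖) = ‖α p.1.1 * γ₀ p.1.2 - α p.1.2 * γ₀ p.1.1‖ := by
      rw [PhilipponMain.projDist_mul_norm_mul_norm hα0 hγ₀ne, hp, coe_nnnorm]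
    set E : MvPolynomial (Fin 3) ℂ := MvPolynomial.C (γ₀ p.1.2) * MvPolynomial.X p.1.1 -
      MvPolynomial.C (γ₀ p.1.1) * MvPolynomial.X p.1.2 with hE
    have hEhom : E.IsHomogeneous 1 := by
      rw [hE, MvPolynomial.C_mul_X_eq_monomial, MvPolynomial.C_mul_X_eq_monomial]
      exact (MvPolynomial.isHomogeneous_monomial _ (by rw [Finsupp.degree_single])).sub
        (MvPolynomial.isHomogeneous_monomial _ (by rw [Finsupp.degree_single]))
    have hEγ₀ : MvPolynomial.eval γ₀ E = 0 := by
      simp only [hE, map_sub, map_mul, MvPolynomial.eval_C, MvPolynomial.eval_X]; ring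
    have hEα : MvPolynomial.eval α E = α p.1.1 * γ₀ p.1.2 - α p.1.2 * γ₀ p.1.1 := by
      simp only [hE, map_sub, map_mul, MvPolynomial.eval_C, MvPolynomial.eval_X]; ring
    have hElen : l1Norm E ≤ 2 * ‖γ₀‖ := by
      rw [hE]
      refine (l1Norm_sub_le _ _).trans ?_
      rw [l1Norm_C_mul_X, l1Norm_C_mul_X]
      have h1 := norm_le_pi_norm γ₀ p.1.2
      have h2 := norm_le_pi_norm γ₀ p.1.1
      linarith
    set P : MvPolynomial (Fin 3) ℂ := MvPolynomial.X k ^ (D - L - 1) * E * Q i₀ with hP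
    have hPhom : P.IsHomogeneous D := by
      have h := ((MvPolynomial.isHomogeneous_X_pow (R := ℂ) k (D - L - 1)).mul hEhom).mul (hQhom i₀)
      rwa [show D - L - 1 + 1 + L = D by omega] at h
    have hPvan : ∀ i : ℕ, i < T → MvPolynomial.eval (γ i) P = 0 := by
      intro i hi
      rw [hP, map_mul, map_mul]
      by_cases hii : i = i₀
      · rw [hii, hEγ₀, mul_zero, zero_mul]
      · rw [hQval i₀ i (hi.trans_le hTM), if_neg hii, mul_zero]
    have hIP := hI P hPhom hPvan
    have hPα : ‖MvPolynomial.eval α P‖ = projDist α γ₀ * ‖γ₀‖ * ‖MvPolynomial.eval α (Q i₀)‖ := by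
      rw [hP, map_mul, map_mul, map_pow, MvPolynomial.eval_X, norm_mul, norm_mul, norm_pow, ← hk,
        one_pow, one_mul, hEα, ← hdist, hα, one_mul]
    have hPlen : l1Norm P ≤ 2 * ‖γ₀‖ * K₁ := by
      rw [hP]
      calc l1Norm (MvPolynomial.X k ^ (D - L - 1) * E * Q i₀)
          ≤ l1Norm (MvPolynomial.X k ^ (D - L - 1) * E) * l1Norm (Q i₀) := l1Norm_mul_le _ _
        _ ≤ (l1Norm (MvPolynomial.X k ^ (D - L - 1)) * l1Norm E) * l1Norm (Q i₀) :=
            mul_le_mul_of_nonneg_right (l1Norm_mul_le _ _) (l1Norm_nonneg _)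
        _ ≤ (1 * (2 * ‖γ₀‖)) * K₁ := by
            rw [l1Norm_X_pow_eq_one]
            exact mul_le_mul (mul_le_mul_of_nonneg_left hElen zero_le_one) (hQlen i₀)
              (l1Norm_nonneg _) (by positivity)
        _ = 2 * ‖γ₀‖ * K₁ := by ring
    -- combine
    have hγ₀pos : 0 < ‖γ₀‖ := norm_pos_iff.mpr hγ₀ne
    have h1 : projDist α γ₀ * ‖MvPolynomial.eval α (Q i₀)‖ ≤ 2 * K₁ * ε := by
      have h2 : projDist α γ₀ * ‖γ₀‖ * ‖MvPolynomial.eval α (Q i₀)‖ ≤ 2 * ‖γ₀‖ * K₁ * ε := by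
        rw [← hPα]; exact hIP.trans (mul_le_mul_of_nonneg_right hPlen hε)
      have h3 : ‖γ₀‖ * (projDist α γ₀ * ‖MvPolynomial.eval α (Q i₀)‖) ≤ ‖γ₀‖ * (2 * K₁ * ε) := by
        calc _ = projDist α γ₀ * ‖γ₀‖ * ‖MvPolynomial.eval α (Q i₀)‖ := by ring
          _ ≤ 2 * ‖γ₀‖ * K₁ * ε := h2
          _ = _ := by ring
      exact le_of_mul_le_mul_left h3 hγ₀pos
    refine ⟨i₀, hiT, ?_⟩
    calc projDist α γ₀ = projDist α γ₀ * 1 := (mul_one _).symm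
      _ ≤ projDist α γ₀ * (M * G ^ L * ‖MvPolynomial.eval α (Q i₀)‖) :=
          mul_le_mul_of_nonneg_left hstar (projDist_nonneg _ _)
      _ = M * G ^ L * (projDist α γ₀ * ‖MvPolynomial.eval α (Q i₀)‖) := by ring
      _ ≤ M * G ^ L * (2 * K₁ * ε) := mul_le_mul_of_nonneg_left h1 (by positivity)
      _ = 2 * (M : ℝ) * K₁ * G ^ L * ε := by ring
  · -- Case `i₀ ≥ T`: the auxiliary form `X_k^{D−L} Q_{i₀}`
    set P : MvPolynomial (Fin 3) ℂ := MvPolynomial.X k ^ (D - L) * Q i₀ with hP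
    have hPhom : P.IsHomogeneous D := by
      have h := (MvPolynomial.isHomogeneous_X_pow (R := ℂ) k (D - L)).mul (hQhom i₀)
      rwa [show D - L + L = D by omega] at h
    have hPvan : ∀ i : ℕ, i < T → MvPolynomial.eval (γ i) P = 0 := by
      intro i hi
      rw [hP, map_mul, hQval i₀ i (hi.trans_le hTM), if_neg (by omega), mul_zero]
    have hIP := hI P hPhom hPvan
    have hPα : ‖MvPolynomial.eval α P‖ = ‖MvPolynomial.eval α (Q i₀)‖ := by
      rw [hP, map_mul, map_pow, MvPolynomial.eval_X, norm_mul, norm_pow, ← hk, one_pow, one_mul]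
    have hPlen : l1Norm P ≤ K₁ := by
      rw [hP]
      refine (l1Norm_mul_le _ _).trans ?_
      rw [l1Norm_X_pow_eq_one, one_mul]
      exact hQlen i₀
    have h1 : ‖MvPolynomial.eval α (Q i₀)‖ ≤ K₁ * ε := by
      rw [← hPα]; exact hIP.trans (mul_le_mul_of_nonneg_right hPlen hε)
    have h2 : (1 : ℝ) ≤ M * K₁ * G ^ L * ε := by
      calc (1 : ℝ) ≤ M * G ^ L * ‖MvPolynomial.eval α (Q i₀)‖ := hstar
        _ ≤ M * G ^ L * (K₁ * ε) := mul_le_mul_of_nonneg_left h1 (by positivity)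
        _ = _ := by ring
    refine ⟨0, hT, (projDist_le_two _ _).trans ?_⟩
    calc (2 : ℝ) = 2 * 1 := (mul_one _).symm
      _ ≤ 2 * (M * K₁ * G ^ L * ε) := by linarith
      _ = 2 * (M : ℝ) * K₁ * G ^ L * ε := by ring

end ClosestPoint

end NguyenRoy

end Literature.NumberTheory.Transcendental
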